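import Mathlib
import Summits.Ventures.PercRepro2.RootCutSums

/-!
# The linear fibre sums of `x` across the root pair
(blind cell PercRepro2, night-1 g33; proofs/NIGHT1-G33.md, the root-shield identity; the masses are
RootCutSums.lean, the ratio sums RootCutRatio.lean, the identity RootCutShield.lean)

Setting of RootCutSums.  Every linear fibre sum of the `x`-exploration is the product of an `S`-side
sum over `T ⊆ VS ∪ {a₁, a₂}` (or `T ⊆ VS` for the `A`-sums) and an `R`-side constant:
`sum_Ssig_S`, `sum_Su_S`, `sum_Ssig_R`, `sum_Su_R`, `sum_SuA_S`, `sum_SuA_R`, and the atoms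
`P(PD) = ρ · ∑_{T ⊆ VS} μ(T)` (`prob_PD_rs`), `P(Q) = ρ · ∑_T μ(T)` (`prob_Q_rs`),
`P(Q, y ∈ U)` (`mU_S`, `mU_R`).  Standard axioms.
-/

namespace Summit.Ventures.PercRepro2

open UnionCluster CovForm CutV

namespace CovForm

namespace A3Fibre

namespace RootShield

/-! ## The linear sums -/

section LinearSums

variable {V : Type*} {E : Type*} [Fintype V] [DecidableEq V] [Fintype E] [DecidableEq E]
  {R : Type*} [Field R] {ends : E → Sym2 V} {a₁ a₂ : V} {VR VS : Finset V} {ER ES : Set E}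
  [DecidablePred (· ∈ ER)] [DecidablePred (· ∈ ES)] {p : E → R}

/-- `∑_W Ssig_y W = ρ · ∑_T (μ_{a₁}^y − μ_{a₂}^y)(T)` for `y` on the `S`-side. -/
lemma sum_Ssig_S (h : RootCut.IsRootCut ends a₁ a₂ ↑VR ↑VS ER ES) {x : V} (hx : x ∈ VS) {y : V}
    (hy : y ∈ (↑VS : Set V) ∪ {a₁, a₂}) :
    ∑ W : Finset V, Ssig p ends a₁ a₂ x y W =
      rhoR p ends a₁ a₂ ER * ∑ T ∈ (insert a₁ (insert a₂ VS)).powerset,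
        (muSc p ends a₁ a₂ ES x a₁ y T - muSc p ends a₁ a₂ ES x a₂ y T) := by
  rw [sum_pairs_of_fibre h hx _ fun W hW => (masses_eq_zero_of_fibre_eq_empty hW y).2.1,
    Finset.mul_sum]
  refine Finset.sum_congr rfl fun T hT => ?_
  rw [Finset.mem_powerset] at hT
  rw [← sum_rhoT h T, Finset.sum_mul]
  refine Finset.sum_congr rfl fun W_R hW => ?_
  rw [Finset.mem_powerset] at hW
  rw [Ssig_pair_S h hx hT hW hy, mul_comm]

/-- `∑_W Su_y W = ρ · ∑_T (μ_{a₁}^y + μ_{a₂}^y)(T)` for `y` on the `S`-side. -/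
lemma sum_Su_S (h : RootCut.IsRootCut ends a₁ a₂ ↑VR ↑VS ER ES) {x : V} (hx : x ∈ VS) {y : V}
    (hy : y ∈ (↑VS : Set V) ∪ {a₁, a₂}) :
    ∑ W : Finset V, Su p ends a₁ a₂ x y W =
      rhoR p ends a₁ a₂ ER * ∑ T ∈ (insert a₁ (insert a₂ VS)).powerset,
        (muSc p ends a₁ a₂ ES x a₁ y T + muSc p ends a₁ a₂ ES x a₂ y T) := by
  rw [sum_pairs_of_fibre h hx _ fun W hW => (masses_eq_zero_of_fibre_eq_empty hW y).2.2,
    Finset.mul_sum]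
  refine Finset.sum_congr rfl fun T hT => ?_
  rw [Finset.mem_powerset] at hT
  rw [← sum_rhoT h T, Finset.sum_mul]
  refine Finset.sum_congr rfl fun W_R hW => ?_
  rw [Finset.mem_powerset] at hW
  rw [Su_pair_S h hx hT hW hy, mul_comm]

/-- `∑_W Ssig_y W = (κ_{a₁}(y) − κ_{a₂}(y)) · ∑_T μ(T)` for `y` on the `R`-side. -/
lemma sum_Ssig_R (h : RootCut.IsRootCut ends a₁ a₂ ↑VR ↑VS ER ES) {x : V} (hx : x ∈ VS) {y : V}
    (hy : y ∈ (↑VR : Set V) ∪ {a₁, a₂}) :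
    ∑ W : Finset V, Ssig p ends a₁ a₂ x y W =
      (kap p ends a₁ a₂ ER a₁ y - kap p ends a₁ a₂ ER a₂ y) *
        ∑ T ∈ (insert a₁ (insert a₂ VS)).powerset, muS p ends a₁ a₂ ES x T := by
  rw [sum_pairs_of_fibre h hx _ fun W hW => (masses_eq_zero_of_fibre_eq_empty hW y).2.1,
    Finset.mul_sum]
  refine Finset.sum_congr rfl fun T hT => ?_
  rw [Finset.mem_powerset] at hT
  rw [← sum_rhoTc h T a₁ y, ← sum_rhoTc h T a₂ y, ← Finset.sum_sub_distrib, Finset.sum_mul]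
  refine Finset.sum_congr rfl fun W_R hW => ?_
  rw [Finset.mem_powerset] at hW
  rw [Ssig_pair_R h hx hT hW hy, mul_comm]

/-- `∑_W Su_y W = (κ_{a₁}(y) + κ_{a₂}(y)) · ∑_T μ(T)` for `y` on the `R`-side. -/
lemma sum_Su_R (h : RootCut.IsRootCut ends a₁ a₂ ↑VR ↑VS ER ES) {x : V} (hx : x ∈ VS) {y : V}
    (hy : y ∈ (↑VR : Set V) ∪ {a₁, a₂}) :
    ∑ W : Finset V, Su p ends a₁ a₂ x y W =
      (kap p ends a₁ a₂ ER a₁ y + kap p ends a₁ a₂ ER a₂ y) *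
        ∑ T ∈ (insert a₁ (insert a₂ VS)).powerset, muS p ends a₁ a₂ ES x T := by
  rw [sum_pairs_of_fibre h hx _ fun W hW => (masses_eq_zero_of_fibre_eq_empty hW y).2.2,
    Finset.mul_sum]
  refine Finset.sum_congr rfl fun T hT => ?_
  rw [Finset.mem_powerset] at hT
  rw [← sum_rhoTc h T a₁ y, ← sum_rhoTc h T a₂ y, ← Finset.sum_add_distrib, Finset.sum_mul]
  refine Finset.sum_congr rfl fun W_R hW => ?_
  rw [Finset.mem_powerset] at hW
  rw [Su_pair_R h hx hT hW hy, mul_comm]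

/-- `∑_{W ∈ A} Su_y W = ρ · ∑_{T ⊆ VS} (μ_{a₁}^y + μ_{a₂}^y)(T)` for `y` on the `S`-side. -/
lemma sum_SuA_S (h : RootCut.IsRootCut ends a₁ a₂ ↑VR ↑VS ER ES) {x : V} (hx : x ∈ VS) {y : V}
    (hy : y ∈ (↑VS : Set V) ∪ {a₁, a₂}) :
    ∑ W ∈ fibresA a₁ a₂, Su p ends a₁ a₂ x y W =
      rhoR p ends a₁ a₂ ER * ∑ T ∈ VS.powerset,
        (muSc p ends a₁ a₂ ES x a₁ y T + muSc p ends a₁ a₂ ES x a₂ y T) := by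
  rw [sum_fibresA_eq h hx _ fun W hW => (masses_eq_zero_of_fibre_eq_empty hW y).2.2,
    Finset.mul_sum]
  refine Finset.sum_congr rfl fun T hT => ?_
  rw [Finset.mem_powerset] at hT
  rw [Su_free_S h hx hT hy, mul_comm]

/-- `∑_{W ∈ A} Su_y W = (κ_{a₁}(y) + κ_{a₂}(y)) · ∑_{T ⊆ VS} μ(T)` for `y` on the `R`-side. -/
lemma sum_SuA_R (h : RootCut.IsRootCut ends a₁ a₂ ↑VR ↑VS ER ES) {x : V} (hx : x ∈ VS) {y : V}
    (hy : y ∈ (↑VR : Set V) ∪ {a₁, a₂}) :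
    ∑ W ∈ fibresA a₁ a₂, Su p ends a₁ a₂ x y W =
      (kap p ends a₁ a₂ ER a₁ y + kap p ends a₁ a₂ ER a₂ y) *
        ∑ T ∈ VS.powerset, muS p ends a₁ a₂ ES x T := by
  rw [sum_fibresA_eq h hx _ fun W hW => (masses_eq_zero_of_fibre_eq_empty hW y).2.2,
    Finset.mul_sum]
  refine Finset.sum_congr rfl fun T hT => ?_
  rw [Finset.mem_powerset] at hT
  rw [Su_free_R h hx hT hy, mul_comm]

/-- `P(PD) = ρ · ∑_{T ⊆ VS} μ(T)`. -/
lemma prob_PD_rs (h : RootCut.IsRootCut ends a₁ a₂ ↑VR ↑VS ER ES) {x : V} (hx : x ∈ VS) :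
    prob p (PDEvent ends a₁ a₂ x) =
      rhoR p ends a₁ a₂ ER * ∑ T ∈ VS.powerset, muS p ends a₁ a₂ ES x T := by
  rw [prob_PD_eq_fibresA,
    sum_fibresA_eq h hx _ fun W hW => (masses_eq_zero_of_fibre_eq_empty hW x).1,
    Finset.mul_sum]
  refine Finset.sum_congr rfl fun T hT => ?_
  rw [Finset.mem_powerset] at hT
  rw [mW_free h hx hT, mul_comm]

/-- `P(Q) = ρ · ∑_T μ(T)` over `T ⊆ VS ∪ {a₁, a₂}`. -/
lemma prob_Q_rs (h : RootCut.IsRootCut ends a₁ a₂ ↑VR ↑VS ER ES) {x : V} (hx : x ∈ VS) :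
    prob p (avoidAll ends a₂ {a₁}) =
      rhoR p ends a₁ a₂ ER * ∑ T ∈ (insert a₁ (insert a₂ VS)).powerset, muS p ends a₁ a₂ ES x T := by
  unfold muS rhoR
  rw [sum_prob_S_cluster_inter p h hx]
  exact RootCut.prob_avoidAll_eq_mul p h

/-- `P(Q, y ∈ U) = ρ · ∑_T (μ_{a₁}^y + μ_{a₂}^y)(T)` for `y` on the `S`-side. -/
lemma mU_S (h : RootCut.IsRootCut ends a₁ a₂ ↑VR ↑VS ER ES) {x : V} (hx : x ∈ VS) {y : V}
    (hy : y ∈ (↑VS : Set V) ∪ {a₁, a₂}) :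
    LeafStep.mU p ends a₁ a₂ y =
      rhoR p ends a₁ a₂ ER * ∑ T ∈ (insert a₁ (insert a₂ VS)).powerset,
        (muSc p ends a₁ a₂ ES x a₁ y T + muSc p ends a₁ a₂ ES x a₂ y T) := by
  rw [← sum_Su_S h hx hy, sum_Su]
  rfl

/-- `P(Q, y ∈ U) = (κ_{a₁}(y) + κ_{a₂}(y)) · ∑_T μ(T)` for `y` on the `R`-side. -/
lemma mU_R (h : RootCut.IsRootCut ends a₁ a₂ ↑VR ↑VS ER ES) {x : V} (hx : x ∈ VS) {y : V}
    (hy : y ∈ (↑VR : Set V) ∪ {a₁, a₂}) :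
    LeafStep.mU p ends a₁ a₂ y =
      (kap p ends a₁ a₂ ER a₁ y + kap p ends a₁ a₂ ER a₂ y) *
        ∑ T ∈ (insert a₁ (insert a₂ VS)).powerset, muS p ends a₁ a₂ ES x T := by
  rw [← sum_Su_R h hx hy, sum_Su]
  rfl

end LinearSums

end RootShield

end A3Fibre

end CovForm

end Summit.Ventures.PercRepro2
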